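import Summits.ResolutionOfSingularities.ResolutionOfSingularities.Theorems.MarkedTransferCampaignW46MohWindowSurfacePureChild
import Summits.ResolutionOfSingularities.ResolutionOfSingularities.Theorems.MarkedTransferCampaignW46MohWindowSurfaceFrozenShape
import Summits.ResolutionOfSingularities.ResolutionOfSingularities.Theorems.MarkedTransferCampaignW46MohWindowSurfaceFreeze
import HarnessLib

/-!
# [OURS · L1 W4.6 rung (iii-2), HEAVY-ROOT SIDE, `p = 2`] Surface Moh window — scheme level: over a PURE cube child every singular
# point of the transform is FROZEN, hence never again an admitted centre inside the regime (cell res-hironaka, LADDER-RESOLUTION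
# rung L, D-0089; seat res-L1-s46-pv-5 gen 4; host MarkedTransfer, `--supports stmt-ResolutionOfSingularities-16155 --as helper`)

HONEST FRAMING. Nothing here is a statement of H. Hironaka's manuscript [Hironaka2017] and nothing here asserts that any
statement of it holds. THEOREMS about the OURS regime `CampaignW46.Regime.mohWindowSurface` (o1) at `p = 2`, assembling
`…PureChild.lean` (ring: the three Rees charts over a pure cube child), `…FrozenShape.lean` (a frozen shape has a simple factor in
every presentation) and `…Freeze.lean` (a centre with a simple factor makes the sequence leave the regime). Step (4) of
res-L1-s46-pv-5's «p = 2 programme». AI-written; AI review is weaker than expert review. No `sorry`; axioms standard.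

WHAT IS PROVED. `exists_frozenShape_of_over_pure`: let `π : Z′ → Z` be a §2.1-permissible blow-up of a state `(A, E)` of
`Regime.mohWindowSurface` (`p = 2`) whose centre point `y` is a PURE cube child — `J_y = (w² + s²η + s q³ G)` for a regular system
of parameters `(s, q, w)` of `𝒪_{Z,y}`, `G` a unit, `η ≡ η_S s + η_Q q + η_W w (mod 𝔪²)` with `η_S` a unit and `η_Q ∈ 𝔪`. Then at
every singular point `x′` of `E′` over `y` the stalk `J′_{x′}` has the FROZEN shape `(w′² + (s′²·(G′q′) + r′))`, `G′` a unit,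
`r′ ∈ 𝔪⁴`, in a regular system of parameters `(s′, q′, w′)` of the regular local ring `𝒪_{Z′,x′}` (embedding dimension `3`).
`not_mohWindowSurface_transform_of_centre_over_pure`: consequently, if later (after any chain of transports by isomorphisms
— here: at the very next stage) such an `x′` is the centre of a permissible blow-up of a state in the regime, the transform leaves
the regime. [ZariskiSamuel1960] [Matsumura1987] [StacksProject, Tag 0804]
-/

noncomputable section

set_option linter.dupNamespace false -- mandated namespace of this single-conjunct summit

open CategoryTheory AlgebraicGeometry TopologicalSpace IsLocalRing

namespace Summit.ResolutionOfSingularities.ResolutionOfSingularities.Theorems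

namespace CampaignW46

open Literature.AlgebraicGeometry.Resolution
open Literature.AlgebraicGeometry.Hironaka2017.S02Preliminaries
open Literature.AlgebraicGeometry.Hironaka2017.Datum
open Literature.AlgebraicGeometry.Hironaka2017.S16Proof
open Scheme.IdealSheafData

universe u

section Campaign

variable {K : Type u} [Field K] [CharP K 2]
variable {A A' : AmbientDatum 2 K} {E : IdealExponent A.Z}

/-- **[OURS · L1 W4.6 rung (iii-2), `p = 2`] OVER A PURE CUBE CHILD EVERY SINGULAR POINT IS FROZEN.** See the module docstring.
NOT a statement of the manuscript. [folklore] -/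
theorem exists_frozenShape_of_over_pure {D : Closeds A.Z} (π : A'.Z ⟶ A.Z) (hπ : IsBlowup π (vanishingIdeal D))
    (hD : E.IsPermissibleCentre A.hom D) (hRg : Regime.mohWindowSurface A E) {y : A.Z} (hyD : y ∈ (D : Set A.Z))
    {s q w η G η_S η_Q η_W : A.Z.presheaf.stalk y} (hsqw : Ideal.span {s, q, w} = maximalIdeal _)
    (hη : η - (η_S * s + η_Q * q + η_W * w) ∈ maximalIdeal _ ^ 2) (hηS : IsUnit η_S) (hηQ : η_Q ∈ maximalIdeal _)
    (hG : IsUnit G) (hJ : stalkIdeal E.J y = Ideal.span {w ^ 2 + (s ^ 2 * η + s * q ^ 3 * G)})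
    {x' : A'.Z} (hx' : x' ∈ (E.transform π D).sing) (hover : π.base x' = y) :
    IsRegularLocalRing (A'.Z.presheaf.stalk x') ∧ (maximalIdeal (A'.Z.presheaf.stalk x')).spanFinrank = 3 ∧
      ∃ s' q' w' G' r' : A'.Z.presheaf.stalk x', Ideal.span {s', q', w'} = maximalIdeal _ ∧ IsUnit G' ∧
        r' ∈ maximalIdeal _ ^ 4 ∧ stalkIdeal (E.transform π D).J x' = Ideal.span {w' ^ 2 + (s' ^ 2 * (G' * q') + r')} := by
  classical
  obtain ⟨y₀, hy₀S, hy₀cl, hDy₀⟩ := IsPermissibleCentre.exists_eq_singleton_of_isolatedSing hD ⟨hRg.2.1, hRg.2.2.1⟩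
  have hy : y = y₀ := by simpa [hDy₀] using hyD
  subst hy
  subst hover
  obtain ⟨hb, -, -, hwin⟩ := hRg
  obtain ⟨hRreg, h3, -⟩ := hwin _ hy₀S
  haveI := hRreg
  haveI : IsLocallyNoetherian A'.Z := by
    haveI := A'.smooth
    exact LocallyOfFiniteType.isLocallyNoetherian A'.hom
  have hY : stalkIdeal (vanishingIdeal D) (π.base x') = maximalIdeal (A.Z.presheaf.stalk (π.base x')) := by
    apply stalkIdeal_vanishingIdeal_eq_maximalIdeal_of_closure_eq
    rw [hDy₀, hy₀cl.closure_eq]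
  set c : Fin 3 → A.Z.presheaf.stalk (π.base x') := ![s, q, w] with hc_def
  have hc : Ideal.span (Set.range c) = maximalIdeal _ := by rw [hc_def, MohWindowSurface.range_vec3]; exact hsqw
  have hcY : Ideal.span (Set.range c) = stalkIdeal (vanishingIdeal D) (π.base x') := hc.trans hY.symm
  obtain ⟨j, 𝔴, χ, hχ, hloc, h𝔴⟩ := hπ.exists_reesChart_stalk x' c hcY
  letI := χ.toAlgebra
  haveI : IsLocalization.AtPrime (A'.Z.presheaf.stalk x') 𝔴.asIdeal := hloc
  obtain ⟨ψ, hψ⟩ : ∃ ψ : A.Z.presheaf.stalk (π.base x') →+* A'.Z.presheaf.stalk x', ψ = (π.stalkMap x').hom := ⟨_, rfl⟩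
  have hψa : ∀ r, ψ r = (algebraMap (chartRing c j) (A'.Z.presheaf.stalk x') :
      chartRing c j →+* A'.Z.presheaf.stalk x') (chartBase c j r) := fun r => by rw [hψ]; exact (hχ r).symm
  have hrel : ∀ l, ψ (c l) = ψ (c j) * χ (chartGen c j l) := by
    rw [hψ]; exact stalkMap_apply_eq_mul_chartGen j χ hχ
  -- the stalk of the transform is the colon `((ψ g) : (ψ c_j)²)`
  have hCmap : (stalkIdeal (vanishingIdeal D) (π.base x')).map ψ = Ideal.span {ψ (c j)} := by
    rw [← hcY, Ideal.map_span_range_eq_span_singleton _ c j _ hrel]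
  have hstalk : stalkIdeal (E.transform π D).J x' =
      Submodule.colon (Ideal.span {ψ (c 2 ^ 2 + (c 0 ^ 2 * η + c 0 * c 1 ^ 3 * G))})
        ((Ideal.span {ψ (c j)} ^ 2 : Ideal _) : Set _) := by
    show stalkIdeal (controlledTransform π (vanishingIdeal D) E.J E.b) x' = _
    rw [controlledTransform, stalkIdeal_colon, stalkIdeal_pow, stalkIdeal_comap_eq_map_stalkMap,
      stalkIdeal_comap_eq_map_stalkMap, ← hψ, hCmap, hJ, Ideal.map_span, Set.image_singleton, hb]
    rfl
  have hx'sing : stalkIdeal (E.transform π D).J x' ≤ maximalIdeal _ ^ 2 := by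
    have := (le_idealOrder_iff (E.transform π D).J x' (E.transform π D).b).mp hx'
    rwa [show (E.transform π D).b = E.b from rfl, hb] at this
  have hη' : η - (η_S * c 0 + η_Q * c 1 + η_W * c 2) ∈ maximalIdeal _ ^ 2 := hη
  exact MohWindowSurface.pureChild_of_chart h3 c hc hη' hηS hηQ hG j 𝔴.asIdeal h𝔴 _ ψ hψa hstalk hx'sing

/-- **[OURS · L1 W4.6 rung (iii-2), `p = 2`] A POINT OVER A PURE CUBE CHILD IS NEVER AN ADMITTED CENTRE.** In the situation of
`exists_frozenShape_of_over_pure`, if the state `(A′, E′)` is in `Regime.mohWindowSurface` and `π′ : Z″ → Z′` is a §2.1-permissible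
blow-up of it whose centre contains the point `x′` (over the pure cube child `y`), then the transform `(A″, E″)` is NOT in
`Regime.mohWindowSurface`: the regime's own coefficient window presentation at `x′` has a residue cubic with a simple prime factor
in the `x`- or the `y`-chart (`exists_simple_factor_of_frozenShape`), and the top-of-window rigidity
(`not_mohWindowSurface_transform_of_simple_root`, `p = 2`, `d = 3`) applies — to the presentation or to its swap. NOT a statement
of the manuscript. [folklore] -/
theorem not_mohWindowSurface_transform_of_centre_over_pure {D : Closeds A.Z} (π : A'.Z ⟶ A.Z)
    (hπ : IsBlowup π (vanishingIdeal D)) (hD : E.IsPermissibleCentre A.hom D) (hRg : Regime.mohWindowSurface A E)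
    {y : A.Z} (hyD : y ∈ (D : Set A.Z)) {s q w η G η_S η_Q η_W : A.Z.presheaf.stalk y}
    (hsqw : Ideal.span {s, q, w} = maximalIdeal _) (hη : η - (η_S * s + η_Q * q + η_W * w) ∈ maximalIdeal _ ^ 2)
    (hηS : IsUnit η_S) (hηQ : η_Q ∈ maximalIdeal _) (hG : IsUnit G)
    (hJ : stalkIdeal E.J y = Ideal.span {w ^ 2 + (s ^ 2 * η + s * q ^ 3 * G)})
    {x' : A'.Z} (hx' : x' ∈ (E.transform π D).sing) (hover : π.base x' = y)
    (hRg' : Regime.mohWindowSurface A' (E.transform π D)) {A'' : AmbientDatum 2 K} {D' : Closeds A'.Z}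
    (π' : A''.Z ⟶ A'.Z) (hπ' : IsBlowup π' (vanishingIdeal D')) (hD' : (E.transform π D).IsPermissibleCentre A'.hom D')
    (hx'D' : x' ∈ (D' : Set A'.Z)) :
    ¬ Regime.mohWindowSurface A'' ((E.transform π D).transform π' D') := by
  classical
  obtain ⟨hLreg, h3L, s', q', w', G', r', hsqw', hG', hr', hJ'⟩ :=
    exists_frozenShape_of_over_pure π hπ hD hRg hyD hsqw hη hηS hηQ hG hJ hx' hover
  haveI := hLreg
  haveI : CharP (A'.Z.presheaf.stalk x') 2 := Lem16p11Proof.charP_stalk A π x'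
  -- the regime's presentation at `x'`
  have hRg'' := hRg'
  obtain ⟨hb', -, -, hwin'⟩ := hRg'
  obtain ⟨-, -, x₁, y₁, z₁, hxyz₁, d₁, a₁, hbd₁, hd2₁, hunit₁, hJ₁⟩ := hwin' _ hx'
  rw [hb'] at hbd₁ hd2₁ hJ₁
  have hd₁ : d₁ = 3 := by omega
  subst hd₁
  -- the frozen shape, read in this presentation
  have hηshape : G' * q' - (0 * s' + G' * q' + 0 * w') ∈ maximalIdeal (A'.Z.presheaf.stalk x') ^ 2 := by
    rw [show G' * q' - (0 * s' + G' * q' + 0 * w') = 0 from by ring]; exact zero_mem _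
  have heq : Ideal.span {w' ^ 2 + (s' ^ 2 * (G' * q') + r')} =
      Ideal.span {z₁ ^ 2 + ∑ k ∈ Finset.range (3 + 1), a₁ k * x₁ ^ (3 - k) * y₁ ^ k} := by rw [← hJ', ← hJ₁]
  rcases MohWindowSurface.exists_simple_factor_of_frozenShape h3L hsqw' hηshape hG' hr' hxyz₁ a₁ heq with
    ⟨π₀, G₀, hπ₀, hF, hG₀⟩ | ⟨π₀, G₀, hπ₀, hF, hG₀⟩
  · exact not_mohWindowSurface_transform_of_simple_root π' hπ' hD' hRg'' hx'D' hxyz₁ (by norm_num) a₁ hJ₁ hπ₀ hF hG₀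
  · -- the swapped presentation `(y₁, x₁)` with reversed coefficients
    have hyxz₁ : Ideal.span {y₁, x₁, z₁} = maximalIdeal _ := by
      rw [← hxyz₁, Set.insert_comm]
    have hJ₁' : stalkIdeal (E.transform π D).J x' =
        Ideal.span {z₁ ^ 2 + ∑ k ∈ Finset.range (3 + 1), a₁ (3 - k) * y₁ ^ (3 - k) * x₁ ^ k} := by
      rw [hJ₁, MohWindowSurface.coeffForm_swap]
    exact not_mohWindowSurface_transform_of_simple_root π' hπ' hD' hRg'' hx'D' hyxz₁ (by norm_num)
      (fun k => a₁ (3 - k)) hJ₁' hπ₀ hF hG₀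

end Campaign

end CampaignW46

end Summit.ResolutionOfSingularities.ResolutionOfSingularities.Theorems

end
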